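import Mathlib
import Literature.NumberTheory.LFunctions.Zhang2022.TypedSection15BEuler
import HarnessLib

/-!
# Zhang (2022) §15 (15.14): the smooth-cutoff / Mellin step for `𝒟₁(d,l)` — PROVED

Topic `Literature/NumberTheory/LFunctions/Zhang2022` (Landau–Siegel audit tree; verdict-neutral).
Y. Zhang, *Discrete mean estimates and the Landau–Siegel zero*, arXiv:2211.02515v1 (2022)
[Zhang2022LandauSiegel] — **an unrefereed manuscript under adjudication** (ZHANG-L discharge lane; this
file proves ONE displayed step BY NAME and says nothing about Theorems 1–2 or Landau–Siegel zeros).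

The node is `Z22:(15.14)` [Z22 p. 84, tex L4184–L4188], typed as `Typed.Section15B.Eq15_14 c′`
(`TypedSection15B.lean`):

> By (4.2), (4.3) and (15.2), we can replace the factor `g̃₃(dn)` by `(dn)^{β₃}g(P₄/(dn))` with a
> negligible error. Thus, by the relation (...) [§15.u029] it follows that
> `𝒟₁(d,l) = λ₁(d)·(1/2πi)∫_{(1)} (Σ_n λ̃₁(n,d)ξ₁(n;d,l)n^{−1−s}) P₄^{s+β₃}d^{−s} ω₁(s+β₃)(s+β₃)⁻¹ ds + O(ε)`.

Proof (kernel-checked here, for every `c′`, all `d, l ≥ 1`, all large `D`; hypothesis (A) unused):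

* `tsum_full_eq_mellin` — the EXACT Mellin identity
  `(1/2π)∫_ℝ integrand1514(1+it) dt = Σ_n λ̃₁(n,d)ξ₁(n;d,l)n⁻¹(dn)^{β₃}g(P₄/(dn))`: translate the line by
  `Im β₃` (`β₃ ∈ iℝ`), absorb `n^{β₃}` into the coefficients, and apply the tree's §4 Mellin pair
  `GaussWeight.integral_LSeries_mul_kernel` ((4.1)) at `X = P₄/d`, `c = 1`, `s = 1`; the absolute
  convergence at `σ = 2` is `Typed.Section15BEuler.lseriesSummable_lamTilde1_mul_xi1`.
* `norm_full_sub_fin_le` — the smooth-cutoff replacement, termwise: `g̃₃(dn) = (dn)^{β₃}g*(P₄/(dn))`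
  differs from `(dn)^{β₃}g(P₄/(dn))` only when `P₄/(dn) ≤ 1/2`, where `g ≤ ½exp{−𝓛³⁰log²(dn/P₄)}` ((4.3),
  `GaussWeight.gWeight_le`) and `exp{−Λlog²x} ≤ 32·exp{−Λlog²2}·x⁻⁵` for `x ≥ 2`, `Λ log 2 ≥ 5`
  (`exp_neg_mul_log_sq_le`); with the uniform majorant `|λ̃₁(n,d)ξ₁(n;d,l)| ≤ K·n`
  (`exists_norm_lamTilde1_mul_xi1_le_linear`, from `Typed.Section15BEuler.norm_lamTilde1_mul_xi1_le` and the
  divisor bound) every term is `≤ 16K·exp{−𝓛³⁰log²2}(P₄/d)⁵·n⁻⁵`.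
* `eq15_14_holds` — sum over `n` (`Σ n⁻⁵` is an absolute constant), multiply by `|λ₁(d)| ≤ d³`
  (`norm_lam1_one_le_pow_three`), and `exp{−𝓛³⁰log²2}·P₄⁵ ≤ exp{−𝓛¹⁰}` once `𝓛 ≥ 3`: the node holds with
  `c = 1` and an absolute `C` — an error far below the printed `ε = exp{−c𝓛¹⁰}`.

No new definition, no new fact; `Skeleton.AssumptionA` is not used (the bound is unconditional).

## References

* Y. Zhang, arXiv:2211.02515v1 (2022), §15 (15.14) p. 84; §4 (4.1)–(4.3) p. 17.
  [cite: Zhang2022LandauSiegel, §15 (15.14) p. 84]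
-/

noncomputable section

open Complex Real Filter MeasureTheory
open scoped Topology

namespace Literature.NumberTheory.LFunctions.Zhang2022.Typed.Section15B

open Literature.NumberTheory.LFunctions.Zhang2022
open Literature.NumberTheory.LFunctions.Zhang2022.Typed.Section15A (lam1 gtilde3 calD1)
open Literature.NumberTheory.LFunctions.Zhang2022.Typed.Section15BEuler
  (norm_lamTilde1_mul_xi1_le lseriesSummable_lamTilde1_mul_xi1 norm_lam1_prime_le)

/-! ## §1. Elementary inputs -/

section Elementary

/-- **Gaussian-tail algebra**: for `x ≥ 2` and `Λ log 2 ≥ 5`,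
`exp{−Λ log²x} ≤ 32·exp{−Λ log²2}·x⁻⁵` (`log²x ≥ log 2·log x`, then split off `5 log x`). [folklore] -/
private theorem exp_neg_mul_log_sq_le {Λ x : ℝ} (hx : 2 ≤ x) (hΛ : 5 ≤ Λ * Real.log 2) :
    Real.exp (-(Λ * Real.log x ^ 2)) ≤ 32 * Real.exp (-(Λ * Real.log 2 ^ 2)) * (x ^ 5)⁻¹ := by
  have hx0 : 0 < x := by linarith
  have hlog2 : 0 < Real.log 2 := Real.log_pos one_lt_two
  have hlx : Real.log 2 ≤ Real.log x := Real.log_le_log two_pos hx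
  have hΛ0 : 0 ≤ Λ := by nlinarith
  -- `Λ log²x ≥ (Λ log 2 − 5)·log 2 + 5·log x`
  have hkey : (Λ * Real.log 2 - 5) * Real.log 2 + 5 * Real.log x ≤ Λ * Real.log x ^ 2 := by
    have h1 : Λ * Real.log 2 * Real.log x ≤ Λ * Real.log x ^ 2 := by
      rw [sq, ← mul_assoc]; exact mul_le_mul_of_nonneg_right (mul_le_mul_of_nonneg_left hlx hΛ0)
        (hlog2.le.trans hlx)
    have h2 : (Λ * Real.log 2 - 5) * Real.log 2 ≤ (Λ * Real.log 2 - 5) * Real.log x :=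
      mul_le_mul_of_nonneg_left hlx (by linarith)
    nlinarith
  have h32 : Real.exp (5 * Real.log 2) = 32 := by
    rw [show (5 : ℝ) * Real.log 2 = ((5 : ℕ) : ℝ) * Real.log 2 by norm_num, Real.exp_nat_mul,
      Real.exp_log two_pos]; norm_num
  have hx5 : Real.exp (5 * Real.log x) = x ^ 5 := by
    rw [show (5 : ℝ) * Real.log x = ((5 : ℕ) : ℝ) * Real.log x by norm_num, Real.exp_nat_mul,
      Real.exp_log hx0]
  calc Real.exp (-(Λ * Real.log x ^ 2))
      ≤ Real.exp (-((Λ * Real.log 2 - 5) * Real.log 2 + 5 * Real.log x)) :=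
        Real.exp_le_exp.mpr (by linarith)
    _ = Real.exp (5 * Real.log 2) * Real.exp (-(Λ * Real.log 2 ^ 2)) * (Real.exp (5 * Real.log x))⁻¹ := by
        rw [← Real.exp_add, ← Real.exp_neg, ← Real.exp_add]; congr 1; ring
    _ = 32 * Real.exp (-(Λ * Real.log 2 ^ 2)) * (x ^ 5)⁻¹ := by rw [h32, hx5]

variable (c' : ℝ) {D : ℕ} (χ : DirichletCharacter ℂ D)

/-- **`|λ₁(d)| ≤ d³`** (`d ≥ 1`): `λ₁(d) = ∏_{q∣d} λ₁(q)` with `|λ₁(q)| ≤ 5 ≤ q³` at every prime and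
`∏_{q∣d} q ≤ d`. [cite: Zhang2022LandauSiegel, §15 (15.10) p. 82] -/
theorem norm_lam1_one_le_pow_three {d : ℕ} (hd : 1 ≤ d) : ‖lam1 c' χ d 1‖ ≤ (d : ℝ) ^ 3 := by
  have hprod : lam1 c' χ d 1 = ∏ q ∈ d.primeFactors, lam1 c' χ q 1 := by
    unfold lam1
    refine Finset.prod_congr rfl fun q hq => ?_
    rw [(Nat.prime_of_mem_primeFactors hq).primeFactors, Finset.prod_singleton]
  rw [hprod, norm_prod]
  calc ∏ q ∈ d.primeFactors, ‖lam1 c' χ q 1‖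
      ≤ ∏ q ∈ d.primeFactors, ((q : ℝ) ^ 3) := by
        refine Finset.prod_le_prod (fun _ _ => norm_nonneg _) fun q hq => ?_
        have hq := Nat.prime_of_mem_primeFactors hq
        have h2 : (2 : ℝ) ≤ q := by exact_mod_cast hq.two_le
        calc ‖lam1 c' χ q 1‖ ≤ 5 := norm_lam1_prime_le c' χ q hq
          _ ≤ 2 ^ 3 := by norm_num
          _ ≤ (q : ℝ) ^ 3 := by gcongr
    _ = ((∏ q ∈ d.primeFactors, q : ℕ) : ℝ) ^ 3 := by
        rw [Finset.prod_pow]; push_cast; rfl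
    _ ≤ (d : ℝ) ^ 3 := by
        gcongr
        exact_mod_cast Nat.le_of_dvd (by omega) (Nat.prod_primeFactors_dvd d)

/-- **Uniform linear majorant `|λ̃₁(n,d)ξ₁(n;d,l)| ≤ K·n`** (one absolute `K`, all `c′, D, χ`, `d, l ≥ 1`,
`n ≥ 1`): `τ(n)^t ≤ (C_{1/t} n^{1/t})^t = C^t·n` (`Typed.Section15BEuler.norm_lamTilde1_mul_xi1_le`, divisor
bound `Sieve.exists_card_divisors_le_mul_rpow`). [cite: Zhang2022LandauSiegel, §15 p. 84 (u030)] -/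
theorem exists_norm_lamTilde1_mul_xi1_le_linear :
    ∃ K : ℝ, 0 < K ∧ ∀ (c' : ℝ) (D : ℕ) (χ : DirichletCharacter ℂ D) (d l : ℕ), 1 ≤ d → 1 ≤ l →
      ∀ n : ℕ, n ≠ 0 → ‖lamTilde1 c' χ n d * xi1 c' χ n d l‖ ≤ K * n := by
  set Z₂ : ℝ := ∑' k : ℕ, ((k : ℝ) + 1) ^ 2 * (1 / 2 : ℝ) ^ k with hZ₂
  have hZ₂0 : 0 ≤ Z₂ := tsum_nonneg fun k => by positivity
  set t : ℝ := (3 : ℝ) + Real.logb 2 (20 * Z₂ + 1) with ht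
  have hlogb : 0 ≤ Real.logb 2 (20 * Z₂ + 1) :=
    Real.logb_nonneg one_lt_two (by linarith [mul_nonneg (show (0:ℝ) ≤ 20 by norm_num) hZ₂0])
  have ht0 : 0 < t := by rw [ht]; linarith
  obtain ⟨C, hC1, hC⟩ :=
    Literature.NumberTheory.Sieve.exists_card_divisors_le_mul_rpow (show 0 < 1 / t by positivity)
  have hC0 : 0 ≤ C := zero_le_one.trans hC1
  refine ⟨C ^ t, Real.rpow_pos_of_pos (one_pos.trans_le hC1) t, fun c' D χ d l hd hl n hn => ?_⟩
  have hnR : (0 : ℝ) < n := by exact_mod_cast Nat.pos_of_ne_zero hn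
  have hτ0 : (0 : ℝ) ≤ n.divisors.card := Nat.cast_nonneg _
  have hτ : (n.divisors.card : ℝ) ≤ C * (n : ℝ) ^ (1 / t) := hC n hn
  calc ‖lamTilde1 c' χ n d * xi1 c' χ n d l‖ ≤ (n.divisors.card : ℝ) ^ t :=
        norm_lamTilde1_mul_xi1_le c' χ hd hl hn
    _ ≤ (C * (n : ℝ) ^ (1 / t)) ^ t := Real.rpow_le_rpow hτ0 hτ ht0.le
    _ = C ^ t * n := by
        rw [Real.mul_rpow hC0 (Real.rpow_nonneg hnR.le _), ← Real.rpow_mul hnR.le,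
          one_div_mul_cancel ht0.ne', Real.rpow_one]

end Elementary

/-! ## §2. The exact Mellin identity for the full `g`-weighted series -/

section Mellin

variable (c' : ℝ) {D : ℕ} (χ : DirichletCharacter ℂ D)

/-- `Re β₃ = 0`. [cite: Zhang2022LandauSiegel, §2 (2.13)] -/
theorem beta3_re (D : ℕ) : (Skeleton.beta3 c' D).re = 0 := by
  rw [beta3_eq_b3_mul_I]; simp

/-- `‖n^{β₃}‖ = 1` for `n ≥ 1`. [cite: Zhang2022LandauSiegel, §2 (2.13)] -/
theorem norm_natCast_cpow_beta3 (D : ℕ) {n : ℕ} (hn : n ≠ 0) :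
    ‖(n : ℂ) ^ Skeleton.beta3 c' D‖ = 1 := by
  rw [Complex.norm_natCast_cpow_of_pos (Nat.pos_of_ne_zero hn), beta3_re, Real.rpow_zero]

/-- `P₄ > 0` once `D ≥ 2`. [cite: Zhang2022LandauSiegel, §6 p. 12] -/
theorem P4_pos (hD : 2 ≤ D) : 0 < Skeleton.P4 D := by
  have hℓ : 0 < Skeleton.ell D := Real.log_pos (by exact_mod_cast hD)
  unfold Skeleton.P4 Skeleton.bigP Skeleton.bigT Skeleton.t0
  exact mul_pos (div_pos (Real.exp_pos _) (pow_pos (Real.exp_pos _) 2)) (pow_pos hℓ 519)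

/-- **The integrand of (15.14) on the line `s = 1 + it`, after the translation `u = t + Im β₃`**: it is
`d^{β₃}` times the `L`-series of `n ↦ λ̃₁(n,d)ξ₁(n;d,l)n^{β₃}` at `1 + (1 + iu)` times the §4 kernel
`(P₄/d)^{1+iu}ω₁(1+iu)/(1+iu)` (`β₃ ∈ iℝ`). [cite: Zhang2022LandauSiegel, §15 (15.14) p. 84] -/
theorem integrand1514_line (hD : 2 ≤ D) {d : ℕ} (hd : 1 ≤ d) (l : ℕ) (t : ℝ) :
    integrand1514 c' χ d l (1 + t * I) =
      (d : ℂ) ^ Skeleton.beta3 c' D *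
        (LSeries (fun n => lamTilde1 c' χ n d * xi1 c' χ n d l * (n : ℂ) ^ Skeleton.beta3 c' D)
            (1 + (((1 : ℝ) : ℂ) + ((t + Skeleton.b3 c' D : ℝ) : ℂ) * I)) *
          GaussWeight.kernel (Skeleton.ell D ^ 30) 1 (Skeleton.P4 D / d) (t + Skeleton.b3 c' D)) := by
  set b : ℝ := Skeleton.b3 c' D with hb
  set β : ℂ := Skeleton.beta3 c' D with hβdef
  have hβ : β = (b : ℂ) * I := beta3_eq_b3_mul_I c' D
  set w : ℂ := ((1 : ℝ) : ℂ) + ((t + b : ℝ) : ℂ) * I with hwdef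
  have hP4 : 0 < Skeleton.P4 D := P4_pos hD
  have hd0 : (d : ℂ) ≠ 0 := by exact_mod_cast (show d ≠ 0 by omega)
  have hdR : (0 : ℝ) < d := by exact_mod_cast (show 0 < d by omega)
  -- the three exponent identities
  have hw1 : (1 : ℂ) + t * I + β = w := by rw [hwdef, hβ]; push_cast; ring
  have hs1 : (1 : ℂ) + t * I = w + -β := by rw [← hw1]; ring
  have hs2 : (1 : ℂ) + (1 + t * I) = (1 + w) + -β := by rw [← hw1]; ring
  -- `w ≠ 0`, `d^w ≠ 0`, `d^β ≠ 0`
  have hw0 : w ≠ 0 := by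
    intro h
    have := congrArg Complex.re h
    simp [hwdef] at this
  have hdw : (d : ℂ) ^ w ≠ 0 := (cpow_ne_zero_iff_of_exponent_ne_zero hw0).mpr hd0
  have hdβ : (d : ℂ) ^ β ≠ 0 := by
    intro h
    rw [cpow_eq_zero_iff] at h
    exact hd0 h.1
  -- the series is the `L`-series at `1 + w`
  have hser : (∑' n : ℕ, lamTilde1 c' χ n d * xi1 c' χ n d l / (n : ℂ) ^ (1 + (1 + t * I))) =
      LSeries (fun n => lamTilde1 c' χ n d * xi1 c' χ n d l * (n : ℂ) ^ β) (1 + w) := by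
    rw [hs2]
    refine tsum_congr fun n => ?_
    rcases eq_or_ne n 0 with rfl | hn
    · rw [LSeries.term_zero]
      have hne : (1 : ℂ) + w + -β ≠ 0 := by
        rw [← hs2]
        intro h
        have := congrArg Complex.re h
        norm_num at this
      simp [Complex.zero_cpow hne]
    · have hn0 : (n : ℂ) ≠ 0 := by exact_mod_cast hn
      rw [LSeries.term_of_ne_zero hn, Complex.cpow_add _ _ hn0, Complex.cpow_neg]
      have hnβ : (n : ℂ) ^ β ≠ 0 := by
        intro h; rw [cpow_eq_zero_iff] at h; exact hn0 h.1
      field_simp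
  -- the power factors
  have hX : (((Skeleton.P4 D / d : ℝ)) : ℂ) ^ w = (Skeleton.P4 D : ℂ) ^ w * ((d : ℂ) ^ w)⁻¹ := by
    rw [div_eq_mul_inv, Complex.ofReal_mul, Complex.mul_cpow_ofReal_nonneg hP4.le
      (inv_nonneg.mpr hdR.le), Complex.ofReal_inv,
      Complex.inv_cpow _ _ (by rw [Complex.ofReal_natCast, Complex.natCast_arg]; exact Real.pi_ne_zero.symm),
      Complex.ofReal_natCast]
  have hdpow : (d : ℂ) ^ ((1 : ℂ) + t * I) = (d : ℂ) ^ w * ((d : ℂ) ^ β)⁻¹ := by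
    rw [hs1, Complex.cpow_add _ _ hd0, Complex.cpow_neg]
  unfold integrand1514 GaussWeight.kernel
  rw [hser, hw1, hdpow, hX, ← hwdef]
  field_simp

/-- **The exact Mellin identity behind (15.14)**: for `D ≥ 2`, `d, l ≥ 1`,
`(1/2π)∫_ℝ integrand1514(1+it) dt = Σ_n λ̃₁(n,d)ξ₁(n;d,l)n⁻¹·(dn)^{β₃}g(P₄/(dn))` — the tree's §4 Mellin pair
`GaussWeight.integral_LSeries_mul_kernel` ((4.1), `(2πi)⁻¹∫_{(1)}(Σₙaₙn^{−1−w})X^wω₁(w)dw/w = Σₙaₙn⁻¹g(X/n)`)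
at `X = P₄/d`, coefficients `aₙ = λ̃₁(n,d)ξ₁(n;d,l)n^{β₃}` (absolutely summable at `σ = 2`,
`Typed.Section15BEuler.lseriesSummable_lamTilde1_mul_xi1`), after translating the line by `Im β₃`.
[cite: Zhang2022LandauSiegel, §15 (15.14) p. 84] -/
theorem mellin1514_eq_tsum (hD : 2 ≤ D) {d l : ℕ} (hd : 1 ≤ d) (hl : 1 ≤ l) :
    (1 / (2 * π) : ℂ) * ∫ t : ℝ, integrand1514 c' χ d l (1 + t * I) =
      ∑' n : ℕ, lamTilde1 c' χ n d * xi1 c' χ n d l / (n : ℂ) *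
        ((((d * n : ℕ) : ℝ) : ℂ) ^ Skeleton.beta3 c' D *
          (Skeleton.gW D (Skeleton.P4 D / ((d * n : ℕ) : ℝ)) : ℂ)) := by
  set Λ : ℝ := Skeleton.ell D ^ 30 with hΛdef
  set b : ℝ := Skeleton.b3 c' D with hb
  set β : ℂ := Skeleton.beta3 c' D with hβdef
  set X : ℝ := Skeleton.P4 D / d with hXdef
  have hℓ : 0 < Skeleton.ell D := Real.log_pos (by exact_mod_cast hD)
  have hΛ : 0 < Λ := pow_pos hℓ 30
  have hP4 : 0 < Skeleton.P4 D := P4_pos hD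
  have hdR : (0 : ℝ) < d := by exact_mod_cast (show 0 < d by omega)
  have hX : 0 < X := div_pos hP4 hdR
  set a : ℕ → ℂ := fun n => lamTilde1 c' χ n d * xi1 c' χ n d l * (n : ℂ) ^ β with ha
  -- absolute convergence at `σ = 2`
  have hs : LSeriesSummable a ((1 : ℂ) + ((1 : ℝ) : ℂ)) := by
    have h2 : (1 : ℂ) + ((1 : ℝ) : ℂ) = 2 := by push_cast; norm_num
    rw [h2]
    have hA := lseriesSummable_lamTilde1_mul_xi1 c' χ hd hl (s := 2) (by norm_num)
    refine Summable.of_norm_bounded hA.norm fun n => ?_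
    rcases eq_or_ne n 0 with rfl | hn
    · simp [LSeries.term_zero]
    · rw [LSeries.term_of_ne_zero hn, LSeries.term_of_ne_zero hn]
      simp only [ha, hβdef, norm_div, norm_mul, norm_natCast_cpow_beta3 c' D hn, mul_one]
      exact le_rfl
  have key := GaussWeight.integral_LSeries_mul_kernel hΛ one_pos hX hs
  -- the left side, translated by `b`
  have hL : (∫ t : ℝ, integrand1514 c' χ d l (1 + t * I)) =
      (d : ℂ) ^ β * ∫ u : ℝ, LSeries a (1 + (((1 : ℝ) : ℂ) + (u : ℂ) * I)) * GaussWeight.kernel Λ 1 X u := by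
    have hfun : (fun t : ℝ => integrand1514 c' χ d l (1 + t * I)) =
        fun t : ℝ => (fun u : ℝ => (d : ℂ) ^ β *
          (LSeries a (1 + (((1 : ℝ) : ℂ) + (u : ℂ) * I)) * GaussWeight.kernel Λ 1 X u)) (t + b) := by
      funext t
      exact integrand1514_line c' χ hD hd l t
    rw [hfun, integral_add_right_eq_self
      (fun u : ℝ => (d : ℂ) ^ β * (LSeries a (1 + (((1 : ℝ) : ℂ) + (u : ℂ) * I)) *
        GaussWeight.kernel Λ 1 X u)) b, integral_const_mul]
  rw [hL, ← mul_assoc, mul_comm (1 / (2 * π) : ℂ), mul_assoc, key, ← tsum_mul_left]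
  refine tsum_congr fun n => ?_
  rcases eq_or_ne n 0 with rfl | hn
  · simp [LSeries.term_zero]
  · have hnR : (0 : ℝ) ≤ n := Nat.cast_nonneg n
    rw [LSeries.term_of_ne_zero hn, Complex.cpow_one, ha]
    have hcast : (((d * n : ℕ) : ℝ) : ℂ) = ((d : ℝ) : ℂ) * ((n : ℝ) : ℂ) := by push_cast; ring
    have hXn : X / n = Skeleton.P4 D / ((d * n : ℕ) : ℝ) := by
      rw [hXdef, div_div]; push_cast; ring
    rw [hcast, Complex.mul_cpow_ofReal_nonneg hdR.le hnR, hXn, Skeleton.gW]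
    push_cast
    ring

end Mellin

/-! ## §3. The smooth-cutoff replacement `g̃₃(dn) ↦ (dn)^{β₃}g(P₄/(dn))`, termwise -/

section Cutoff

variable (c' : ℝ) {D : ℕ} (χ : DirichletCharacter ℂ D)

/-- **The termwise replacement error** ((4.3) + (15.2)): with `A(n) = λ̃₁(n,d)ξ₁(n;d,l)`, `|A(n)| ≤ Kn`, the
difference between the full term `A(n)n⁻¹(dn)^{β₃}g(P₄/(dn))` and the term `A(n)g̃₃(dn)n⁻¹` of §15.u028
vanishes unless `P₄/(dn) ≤ 1/2`, and is always `≤ 16K·exp{−𝓛³⁰log²2}·(P₄/d)⁵·n⁻⁵`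
(`𝓛³⁰ log 2 ≥ 5`). [cite: Zhang2022LandauSiegel, §15 (15.14) p. 84; §4 (4.3)] -/
theorem norm_full_sub_fin_le (hD : 2 ≤ D) (hΛ5 : 5 ≤ Skeleton.ell D ^ 30 * Real.log 2)
    {d l : ℕ} (hd : 1 ≤ d) {K : ℝ} (hK0 : 0 ≤ K)
    (hK : ∀ n : ℕ, n ≠ 0 → ‖lamTilde1 c' χ n d * xi1 c' χ n d l‖ ≤ K * n) (n : ℕ) :
    ‖lamTilde1 c' χ n d * xi1 c' χ n d l / (n : ℂ) *
          ((((d * n : ℕ) : ℝ) : ℂ) ^ Skeleton.beta3 c' D *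
            (Skeleton.gW D (Skeleton.P4 D / ((d * n : ℕ) : ℝ)) : ℂ)) -
        lamTilde1 c' χ n d * xi1 c' χ n d l * gtilde3 c' D ((d * n : ℕ) : ℝ) / (n : ℂ)‖ ≤
      16 * K * Real.exp (-(Skeleton.ell D ^ 30 * Real.log 2 ^ 2)) * (Skeleton.P4 D / d) ^ 5 /
        (n : ℝ) ^ 5 := by
  set Λ : ℝ := Skeleton.ell D ^ 30 with hΛdef
  have hℓ : 0 < Skeleton.ell D := Real.log_pos (by exact_mod_cast hD)
  have hΛ : 0 < Λ := pow_pos hℓ 30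
  have hP4 : 0 < Skeleton.P4 D := P4_pos hD
  have hdR : (0 : ℝ) < d := by exact_mod_cast (show 0 < d by omega)
  have hE0 : 0 ≤ Real.exp (-(Λ * Real.log 2 ^ 2)) := (Real.exp_pos _).le
  rcases eq_or_ne n 0 with rfl | hn
  · simp
  have hnR : (0 : ℝ) < n := by exact_mod_cast Nat.pos_of_ne_zero hn
  have hdn : (0 : ℝ) < ((d * n : ℕ) : ℝ) := by
    exact_mod_cast Nat.mul_pos (by omega) (Nat.pos_of_ne_zero hn)
  set A : ℂ := lamTilde1 c' χ n d * xi1 c' χ n d l with hA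
  set y : ℝ := Skeleton.P4 D / ((d * n : ℕ) : ℝ) with hy
  have hy0 : 0 < y := div_pos hP4 hdn
  -- the right-hand side is non-negative
  have hRHS : 0 ≤ 16 * K * Real.exp (-(Λ * Real.log 2 ^ 2)) * (Skeleton.P4 D / d) ^ 5 / (n : ℝ) ^ 5 := by
    positivity
  -- the difference is `A/n · (dn)^{β₃} · (g(y) − g*(y))`
  have hdiff : A / (n : ℂ) * ((((d * n : ℕ) : ℝ) : ℂ) ^ Skeleton.beta3 c' D * (Skeleton.gW D y : ℂ)) -
      A * gtilde3 c' D ((d * n : ℕ) : ℝ) / (n : ℂ) =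
      A / (n : ℂ) * (((d * n : ℕ) : ℝ) : ℂ) ^ Skeleton.beta3 c' D *
        ((Skeleton.gW D y : ℂ) - (Skeleton.gstar D y : ℂ)) := by
    rw [gtilde3, ← hy]; ring
  have hnormβ : ‖(((d * n : ℕ) : ℝ) : ℂ) ^ Skeleton.beta3 c' D‖ = 1 := by
    rw [Complex.ofReal_natCast]
    exact norm_natCast_cpow_beta3 c' D (mul_ne_zero (by omega) hn)
  have hAn : ‖A / (n : ℂ)‖ ≤ K := by
    rw [norm_div, Complex.norm_natCast, div_le_iff₀ hnR]
    exact hK n hn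
  rw [hdiff, norm_mul, norm_mul, hnormβ, mul_one]
  by_cases hhalf : 1 / 2 < y
  · -- no replacement error
    have : Skeleton.gstar D y = Skeleton.gW D y := by rw [Skeleton.gstar, if_pos hhalf]
    rw [this, sub_self, norm_zero, mul_zero]
    exact hRHS
  · -- `g*(y) = 0`, `g(y) ≤ ½exp{−Λlog²y}`, `log²y = log²(1/y)`, `1/y = dn/P₄ ≥ 2`
    have hy1 : y ≤ 1 := by linarith [not_lt.mp hhalf]
    have hg0 : Skeleton.gstar D y = 0 := by rw [Skeleton.gstar, if_neg hhalf]
    have hgpos : 0 < Skeleton.gW D y := GaussWeight.gWeight_pos hΛ _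
    have hgle : Skeleton.gW D y ≤ (1 / 2) * Real.exp (-Λ * Real.log y ^ 2) :=
      GaussWeight.gWeight_le hΛ hy0 hy1
    set x : ℝ := ((d * n : ℕ) : ℝ) / Skeleton.P4 D with hx
    have hxy : x = y⁻¹ := by rw [hx, hy, inv_div]
    have hx2 : 2 ≤ x := by
      rw [hxy]
      have := not_lt.mp hhalf
      rw [le_inv_comm₀ two_pos hy0]; linarith
    have hlog : Real.log y ^ 2 = Real.log x ^ 2 := by
      rw [hxy, Real.log_inv, neg_sq]
    have htail := exp_neg_mul_log_sq_le hx2 hΛ5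
    have hx5 : (x ^ 5)⁻¹ = (Skeleton.P4 D / d) ^ 5 / (n : ℝ) ^ 5 := by
      rw [hx, ← inv_pow, inv_div]
      push_cast
      simp only [div_pow, mul_pow, div_div]
    rw [hg0, Complex.ofReal_zero, sub_zero, Complex.norm_real, Real.norm_eq_abs, abs_of_pos hgpos]
    calc ‖A / (n : ℂ)‖ * Skeleton.gW D y
        ≤ K * ((1 / 2) * Real.exp (-Λ * Real.log y ^ 2)) :=
          mul_le_mul hAn hgle hgpos.le hK0
      _ = K * ((1 / 2) * Real.exp (-(Λ * Real.log x ^ 2))) := by rw [hlog, neg_mul]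
      _ ≤ K * ((1 / 2) * (32 * Real.exp (-(Λ * Real.log 2 ^ 2)) * (x ^ 5)⁻¹)) := by
          gcongr
      _ = 16 * K * Real.exp (-(Λ * Real.log 2 ^ 2)) * (Skeleton.P4 D / d) ^ 5 / (n : ℝ) ^ 5 := by
          rw [hx5]; ring

end Cutoff

/-! ## §4. Assembly: (15.14) holds -/

section Assembly

/-- **The scale inequality**: `exp{−𝓛³⁰log²2}·P₄⁵ ≤ exp{−𝓛¹⁰}` for `𝓛 ≥ 3`
(`P₄ = PT⁻²t₀ ≤ exp{𝓛⁹}𝓛⁵¹⁹ ≤ exp{𝓛⁹ + 519𝓛}`, `log²2 ≥ 0.48`, `𝓛³⁰ ≥ 3²⁰𝓛¹⁰`).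
[cite: Zhang2022LandauSiegel, §6 p. 12 (P₄); §2 (2.1)] -/
theorem exp_neg_ell_pow_mul_P4_pow_le {D : ℕ} (hℓ : 3 ≤ Skeleton.ell D) :
    Real.exp (-(Skeleton.ell D ^ 30 * Real.log 2 ^ 2)) * Skeleton.P4 D ^ 5 ≤
      Real.exp (-1 * Skeleton.ell D ^ 10) := by
  set L : ℝ := Skeleton.ell D with hL
  have hL0 : 0 ≤ L := by linarith
  have hL1 : 1 ≤ L := by linarith
  -- `P₄ ≤ exp(L⁹ + 519 L)`
  have hP4 : Skeleton.P4 D ≤ Real.exp (L ^ 9 + 519 * L) := by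
    have hT : 1 ≤ Skeleton.bigT D ^ 2 := one_le_pow₀ (Real.one_le_exp (by positivity))
    have ht0 : Skeleton.t0 D ≤ Real.exp (519 * L) := by
      rw [Skeleton.t0, ← hL, show (519 : ℝ) * L = ((519 : ℕ) : ℝ) * L by norm_num, Real.exp_nat_mul]
      exact pow_le_pow_left₀ hL0 (by linarith [Real.add_one_le_exp L]) 519
    have ht0' : 0 ≤ Skeleton.t0 D := by rw [Skeleton.t0]; positivity
    calc Skeleton.P4 D = Skeleton.bigP D / Skeleton.bigT D ^ 2 * Skeleton.t0 D := rfl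
      _ ≤ Skeleton.bigP D * Skeleton.t0 D := by
          refine mul_le_mul_of_nonneg_right (div_le_self (Real.exp_pos _).le hT) ht0'
      _ ≤ Real.exp (L ^ 9) * Real.exp (519 * L) :=
          mul_le_mul le_rfl ht0 ht0' (Real.exp_pos _).le
      _ = Real.exp (L ^ 9 + 519 * L) := by rw [← Real.exp_add]
  have hP40 : 0 ≤ Skeleton.P4 D := by
    rw [Skeleton.P4, Skeleton.t0, Skeleton.bigP, Skeleton.bigT]; positivity
  have hP45 : Skeleton.P4 D ^ 5 ≤ Real.exp (5 * (L ^ 9 + 519 * L)) := by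
    rw [show (5 : ℝ) * (L ^ 9 + 519 * L) = ((5 : ℕ) : ℝ) * (L ^ 9 + 519 * L) by norm_num,
      Real.exp_nat_mul]
    exact pow_le_pow_left₀ hP40 hP4 5
  -- the exponent comparison
  have hlog2 : (0.48 : ℝ) ≤ Real.log 2 ^ 2 := by
    have := Real.log_two_gt_d9; nlinarith
  have h30 : (3 : ℝ) ^ 20 * L ^ 10 ≤ L ^ 30 := by
    calc (3 : ℝ) ^ 20 * L ^ 10 ≤ L ^ 20 * L ^ 10 := by gcongr
      _ = L ^ 30 := by ring
  have h9 : L ^ 9 ≤ L ^ 10 := pow_le_pow_right₀ hL1 (by norm_num)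
  have h1' : L ≤ L ^ 10 := le_self_pow₀ hL1 (by norm_num)
  have hexp : -(L ^ 30 * Real.log 2 ^ 2) + 5 * (L ^ 9 + 519 * L) ≤ -1 * L ^ 10 := by
    nlinarith [pow_nonneg hL0 10, pow_nonneg hL0 30]
  calc Real.exp (-(L ^ 30 * Real.log 2 ^ 2)) * Skeleton.P4 D ^ 5
      ≤ Real.exp (-(L ^ 30 * Real.log 2 ^ 2)) * Real.exp (5 * (L ^ 9 + 519 * L)) :=
        mul_le_mul_of_nonneg_left hP45 (Real.exp_pos _).le
    _ = Real.exp (-(L ^ 30 * Real.log 2 ^ 2) + 5 * (L ^ 9 + 519 * L)) := by rw [Real.exp_add]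
    _ ≤ Real.exp (-1 * L ^ 10) := Real.exp_le_exp.mpr hexp

/-- **`Z22:(15.14)` HOLDS** (`Typed.Section15B.Eq15_14 c′`, §15 p. 84, tex L4184–L4188), for every `c′`: for
all large `D` (`𝓛 ≥ 3`), every real primitive `χ (mod D)` and all `d, l ≥ 1`,
`‖𝒟₁(d,l) − λ₁(d)·(1/2πi)∫_{(1)}(Σₙλ̃₁ξ₁n^{−1−s})P₄^{s+β₃}d^{−s}ω₁(s+β₃)(s+β₃)⁻¹ds‖ ≤ C·exp{−𝓛¹⁰}` with an
absolute `C` (`c = 1`): §15.u028 (`step15_u028_holds`) + the exact Mellin identity `mellin1514_eq_tsum` +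
the termwise cutoff error `norm_full_sub_fin_le` summed over `n` + `|λ₁(d)| ≤ d³` + `exp_neg_ell_pow_mul_P4_pow_le`.
Hypothesis (A) is not used. [cite: Zhang2022LandauSiegel, §15 (15.14) p. 84] -/
theorem eq15_14_holds (c' : ℝ) : Eq15_14 c' := by
  obtain ⟨K, hK0, hK⟩ := exists_norm_lamTilde1_mul_xi1_le_linear
  have hS5 : Summable fun n : ℕ => ((n : ℝ) ^ 5)⁻¹ := Real.summable_nat_pow_inv.mpr (by norm_num)
  set S₅ : ℝ := ∑' n : ℕ, ((n : ℝ) ^ 5)⁻¹ with hS₅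
  have hS50 : 0 ≤ S₅ := tsum_nonneg fun n => by positivity
  refine ⟨1, one_pos, 16 * K * S₅, Skeleton.ForAllLarge.of_le ⌈Real.exp 3⌉₊ fun D _ χ hD _ _ => ?_⟩
  intro _ d l hd hl
  -- scales
  have hlog : 3 ≤ Skeleton.ell D := by
    have h : Real.exp 3 ≤ D := le_trans (Nat.le_ceil _) (by exact_mod_cast hD)
    exact (Real.le_log_iff_exp_le (lt_of_lt_of_le (Real.exp_pos _) h)).mpr h
  have hD2 : 2 ≤ D := by
    by_contra h
    have : (D : ℝ) ≤ 1 := by exact_mod_cast (by omega : D ≤ 1)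
    have : Skeleton.ell D ≤ 0 := Real.log_nonpos (Nat.cast_nonneg D) this
    linarith
  have hΛ5 : 5 ≤ Skeleton.ell D ^ 30 * Real.log 2 := by
    have h3 : (3 : ℝ) ^ 30 ≤ Skeleton.ell D ^ 30 := pow_le_pow_left₀ (by norm_num) hlog 30
    have := Real.log_two_gt_d9
    nlinarith
  have hdR : (0 : ℝ) < d := by exact_mod_cast (show 0 < d by omega)
  have hP4 : 0 < Skeleton.P4 D := P4_pos hD2
  -- both sides as `λ₁(d)` times a sum
  rw [step15_u028_holds c' D χ d l hd hl, mellin1514_eq_tsum c' χ hD2 hd hl, ← mul_sub, norm_mul]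
  -- the two term functions
  set fin : ℕ → ℂ := fun n =>
    lamTilde1 c' χ n d * xi1 c' χ n d l * gtilde3 c' D ((d * n : ℕ) : ℝ) / (n : ℂ) with hfin
  set full : ℕ → ℂ := fun n =>
    lamTilde1 c' χ n d * xi1 c' χ n d l / (n : ℂ) *
      ((((d * n : ℕ) : ℝ) : ℂ) ^ Skeleton.beta3 c' D *
        (Skeleton.gW D (Skeleton.P4 D / ((d * n : ℕ) : ℝ)) : ℂ)) with hfull
  set B : ℝ := 16 * K * Real.exp (-(Skeleton.ell D ^ 30 * Real.log 2 ^ 2)) * (Skeleton.P4 D / d) ^ 5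
    with hB
  have hB0 : 0 ≤ B := by positivity
  have hbound : ∀ n : ℕ, ‖full n - fin n‖ ≤ B * ((n : ℝ) ^ 5)⁻¹ := by
    intro n
    have h := norm_full_sub_fin_le c' χ hD2 hΛ5 hd hK0.le (hK c' D χ d l hd hl) n
    simpa only [hfull, hfin, hB, div_eq_mul_inv] using h
  -- `fin` has finite support: it vanishes off `Icc 1 ⌊2P₄⌋`
  have hfin0 : ∀ n ∉ Finset.Icc 1 ⌊2 * Skeleton.P4 D⌋₊, fin n = 0 := by
    intro n hn
    rw [Finset.mem_Icc, not_and_or, not_le, not_le] at hn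
    rcases hn with hn | hn
    · have : n = 0 := by omega
      subst this; simp [hfin]
    · have hlt : 2 * Skeleton.P4 D < ((d * n : ℕ) : ℝ) := by
        have h1 : 2 * Skeleton.P4 D < n := by
          have := Nat.lt_of_floor_lt hn; exact_mod_cast this
        calc 2 * Skeleton.P4 D < n := h1
          _ = 1 * (n : ℝ) := (one_mul _).symm
          _ ≤ (d : ℝ) * n := by gcongr; exact_mod_cast hd
          _ = ((d * n : ℕ) : ℝ) := by push_cast; ring
      simp only [hfin, Section15A.gtilde3_eq_zero c' hlt, mul_zero, zero_div]
  have hfinS : Summable fin := summable_of_ne_finset_zero hfin0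
  have hdiffS : Summable fun n => full n - fin n :=
    Summable.of_norm_bounded (hS5.mul_left B) hbound
  have hfullS : Summable full := (hfinS.add hdiffS).congr fun n => by ring
  -- rewrite both sums as one series
  have hfs : ∑' n, fin n = ∑ n ∈ Finset.Icc 1 ⌊2 * Skeleton.P4 D⌋₊, fin n := tsum_eq_sum hfin0
  rw [← hfs, ← Summable.tsum_sub hfinS hfullS]
  -- the series of differences
  have hnormS : Summable fun n => ‖fin n - full n‖ := by
    refine Summable.of_norm_bounded (hS5.mul_left B) fun n => ?_
    rw [Real.norm_eq_abs, abs_norm, norm_sub_rev]; exact hbound n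
  have hsum : ‖∑' n, (fin n - full n)‖ ≤ B * S₅ := by
    calc ‖∑' n, (fin n - full n)‖ ≤ ∑' n, ‖fin n - full n‖ := norm_tsum_le_tsum_norm hnormS
      _ ≤ ∑' n : ℕ, B * ((n : ℝ) ^ 5)⁻¹ :=
          Summable.tsum_le_tsum (fun n => by rw [norm_sub_rev]; exact hbound n) hnormS (hS5.mul_left B)
      _ = B * S₅ := by rw [tsum_mul_left]
  -- `|λ₁(d)| ≤ d³` and `d³(P₄/d)⁵ ≤ P₄⁵`
  have hlam : ‖lam1 c' χ d 1‖ ≤ (d : ℝ) ^ 3 := norm_lam1_one_le_pow_three c' χ hd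
  have hd3 : (d : ℝ) ^ 3 * (Skeleton.P4 D / d) ^ 5 ≤ Skeleton.P4 D ^ 5 := by
    have hd1 : (1 : ℝ) ≤ d := by exact_mod_cast hd
    rw [div_pow, ← mul_div_assoc, div_le_iff₀ (by positivity)]
    calc (d : ℝ) ^ 3 * Skeleton.P4 D ^ 5 ≤ (d : ℝ) ^ 5 * Skeleton.P4 D ^ 5 :=
          mul_le_mul_of_nonneg_right (pow_le_pow_right₀ hd1 (by norm_num)) (by positivity)
      _ = Skeleton.P4 D ^ 5 * (d : ℝ) ^ 5 := mul_comm _ _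
  have hscale := exp_neg_ell_pow_mul_P4_pow_le hlog
  calc ‖lam1 c' χ d 1‖ * ‖∑' n, (fin n - full n)‖
      ≤ (d : ℝ) ^ 3 * (B * S₅) := mul_le_mul hlam hsum (norm_nonneg _) (by positivity)
    _ = 16 * K * S₅ * (Real.exp (-(Skeleton.ell D ^ 30 * Real.log 2 ^ 2)) *
          ((d : ℝ) ^ 3 * (Skeleton.P4 D / d) ^ 5)) := by rw [hB]; ring
    _ ≤ 16 * K * S₅ * (Real.exp (-(Skeleton.ell D ^ 30 * Real.log 2 ^ 2)) * Skeleton.P4 D ^ 5) := by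
          gcongr
    _ ≤ 16 * K * S₅ * Real.exp (-1 * Skeleton.ell D ^ 10) := by gcongr

variable (c' : ℝ) in
/-- `Eq15_14` — `_holds` alias of `eq15_14_holds` above under the fact's exact name, stated under the
prover's own binders as section variables (appended 2026-08-28, D-0026 bookkeeping: the proof term is the
existing theorem of this file; no statement, definition or attribute is edited; no new named fact; the
ledger's debt table listed the fact unproved). [cite: Zhang2022LandauSiegel, §15 (15.14) p. 84] -/
theorem _root_.Literature.NumberTheory.LFunctions.Zhang2022.Typed.Section15B.Eq15_14_holds :
    _root_.Literature.NumberTheory.LFunctions.Zhang2022.Typed.Section15B.Eq15_14 c' :=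
  _root_.Literature.NumberTheory.LFunctions.Zhang2022.Typed.Section15B.eq15_14_holds (c' := c')

end Assembly

end Literature.NumberTheory.LFunctions.Zhang2022.Typed.Section15B
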